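import Literature.Probability.Percolation.ArmSeparationFenceBoundAt
import Literature.Probability.Percolation.TriLowestCrossingPairs
import HarnessLib

/-!
# Same-colour tip spacing for Kesten's separation step: the exclusion clause and its failure bound, at `p`

Topic `Literature/Probability/Percolation`; family `crit-perc` / near-critical percolation on `𝕋`
(`P_p = triSitePercolation p`, any `p`). A brick of the near-critical arm-separation theorem for
four arms in the ADJACENT colour arrangement (P. Nolin, *Near-critical percolation in two
dimensions*, EJP 13 (2008), Thm. 11 for `j = 4`, `σ = BBWW` [arXiv 0711.4948: Thm. 10]), the last
missing input (`hsepAdj`) of the tree's proof of Werner's Lemma 6.3 for the order-free `π̂_t`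
(`Werner2009_lemma63_of_altSeparation_of_adjSeparation`, `ArcFourArmStability.lean`).

For two consecutive arms of the SAME colour the separation step must produce two fenced tips
that are far apart. Nolin (§4.4, proof of Lemma 15 [arXiv Lemma 14]): "Assume for instance that
`σ̃_u = B`. With probability at least `1 - (1-δ'')^{-C''₄ log η}` we observe a white circuit in one
of the annuli in the first set, preventing other disjoint black crossings to arrive near `z_u`".
In the tree's exploration framework (`TriLowestCrossing.lean`, `ArmSeparationFenceBound(At).lean`:
the `u`-th lowest open crossing `c_u` of the trapezoid behind side `0`, its tip `z_u`, the per-scale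
RSW events `trapRSW z k` about the tip in configurations agreeing with `ω` off `lower c z`) this is
the following EXCLUSION CLAUSE, added here to the per-scale success event at the scales
`k_j = k₀ · 32^j`:

* `triRingAt z k` — **the ring at scale `k` about `z`**: the four strips of the square annulus
  `{17k ≤ ‖· - z‖_∞ ≤ 31k}` crossed the long way (aspect ratio `62/14`), chosen to fit strictly
  between the supports `{k ≤ ‖·-z‖_∞ ≤ 16k}` of `trapRSW z k` and `{32k ≤ ‖·-z‖_∞}` of the next scale;
  `le_real_triRingAt_of_rsw` (`c ≤ P_q(LR(62k, 14k))` gives `c⁴ ≤ P_q(triRingAt z k)`, Harris);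
* `not_pathIn_of_closed_ring` — **deterministic exclusion**: if `ω'` agrees with `ω` off a set `L`
  of sites and the ring about `z` is CLOSED in `ω'`, then no `ω`-open path avoiding `L` joins the
  box `{‖· - z‖_∞ ≤ 17k}` to the outside of `{‖· - z‖_∞ < 31k}` — it would meet the ring at a site
  closed in `ω'`, open in `ω`, and off `L` (`PathIn.meets_annulus_crossings`). With
  `L = lower c_u z_u` this forbids OPEN paths of `above c_u` (in particular later terms of the
  sequence, and the rerouted upper arm of a same-colour pair, which lie above `c_u` and reach the
  inner side of the trapezoid) from coming within `17k` of the tip `z_u`;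
* `trapRSW₂ z k := trapRSW z k ∩ compl ⁻¹' triRingAt z k`, `TrapFenceOK₂` (fence, protection AND
  exclusion), `trapFenceOK₂_of_mem_trapRSW₂`, `TrapSeqFail₂`, `TrapNoRSW₂`,
  `determinedBy_trapNoRSW₂`, `trapNoRSW₂_of_fail`;
* `real_trapRSW₂_ge_at` — `P_p(trapRSW₂ z k) ≥ c_F² c_E` (disjoint supports);
  `real_iInter_compl_trapRSW₂_le_at` — independent scales, `≤ (1 - c_F² c_E)^K`;
  `real_trapSeqFail₂_le_at` — **the union bound over the values of the `u`-th lowest crossing**,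
  `P_p(TrapSeqFail₂ M u k₀ K) ≤ P_p(lowestSeq u ≠ none) · (1 - c_F² c_E)^K` (`32 k_j + 1 ≤ M`), verbatim
  the proof of `real_trapSeqFail_le_at` with the extra factor (`c_E ≤ P_p(ring closed)` is a
  crossing bound at the DUAL density `1 - p`).

Everything here is proved; no named facts are introduced.

## References

* P. Nolin, Near-critical percolation in two dimensions, *Electron. J. Probab.* 13 (2008), §4.4,
  proof of Lemma 15 (arXiv 0711.4948: Lemma 14, (4.18)–(4.19): the circuits "preventing other
  disjoint black crossings to arrive near `z_u`"), with Thm. 11 "uniformly in `p`" [Nolin2008].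
* H. Kesten, Scaling relations for 2D-percolation, *Comm. Math. Phys.* 109 (1987), Lemma 2
  [Kesten1987].
* G. Grimmett, *Percolation*, 2nd ed. (1999), §11.7–11.8 (RSW frames) [GrimmettPercolation1999].

Tree: `trapRSW`, `determinedBy_trapRSW`, `isUpperSet_trapRSW`, `measurableSet_trapRSW`,
`trapScale`, `trapScale_lt`, `one_le_trapScale`, `TrapFenceOK`, `trapFenceOK_of_mem_trapRSW`,
`trapPairs`, `mem_trapPairs_of_lowestSeq`, `triSqAnnulusFinset`, `mem_triSqAnnulusFinset`
(`ArmSeparationFenceBound.lean`); `sq_le_real_trapRSW_at` (`ArmSeparationFenceBoundAt.lean`);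
`trapDomain`, `trapDomain_cutProp/dualProp`, `JDomain.lowestSeq`, `determinedBy_lowestSeq_eq`,
`disjoint_setOf_lowestSeq_eq`, `isCrossing_of_lowestSeq`; `triHCross`, `triVCross`, `triStrip`,
`triStripFinset`, `determinedBy_triHCross/VCross`, `isUpperSet_triHCross/VCross`,
`triSitePercolation_real_triHCross/VCross` (`TriRSWChaining.lean`); `PathIn.meets_annulus_crossings`
(`TriPathCrossings.lean`); `sitePercolation_harris`, `sitePercolation_real_inter_of_disjoint`,
`sitePercolation_real_preimage_compl`, `DeterminedBy.compl`.
-/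

noncomputable section

open MeasureTheory Set

namespace Literature.Probability.Percolation

open LatticeModels

/-! ### The ring about a site -/

/-- **The open ring at scale `k` about `z`**: the four strips
`[z₀-31k, z₀+31k] × [z₁+17k, z₁+31k]`, `[z₀-31k, z₀+31k] × [z₁-31k, z₁-17k]` (crossed horizontally)
and `[z₀-31k, z₀-17k] × [z₁-31k, z₁+31k]`, `[z₀+17k, z₀+31k] × [z₁-31k, z₁+31k]` (crossed vertically)
of the square annulus `{17k ≤ ‖· - z‖_∞ ≤ 31k}` are each crossed the long way by open sites (as
`triFrameAt`, at a thinner aspect ratio so as to fit between the scales `16k` and `32k`). [cite: Nolin2008, §4.4 Lemma 15 (proof) (arXiv 0711.4948: Lemma 14, the annuli about z_u)] -/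
def triRingAt (z : Site 2) (k : ℕ) : Set (SiteConfig (Site 2)) :=
  (triHCross (z 0 - 31 * k) (z 1 + 17 * k) (62 * k) (14 * k) ∩ triHCross (z 0 - 31 * k) (z 1 - 31 * k) (62 * k) (14 * k)) ∩
    (triVCross (z 0 - 31 * k) (z 1 - 31 * k) (14 * k) (62 * k) ∩ triVCross (z 0 + 17 * k) (z 1 - 31 * k) (14 * k) (62 * k))

/-- The ring at scale `k` is determined by the square annulus `{17k ≤ ‖· - z‖_∞ ≤ 31k}`. [folklore] -/
theorem determinedBy_triRingAt (z : Site 2) (k : ℕ) :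
    DeterminedBy (triRingAt z k) ↑(triSqAnnulusFinset z (17 * k) (31 * k)) := by
  have sub : ∀ (a b : ℤ) (m n : ℕ), (∀ v : Site 2, v ∈ triStrip a b m n → v ∈ triSqAnnulusFinset z (17 * k) (31 * k)) →
      (↑(triStripFinset a b m n) : Set (Site 2)) ⊆ ↑(triSqAnnulusFinset z (17 * k) (31 * k)) := by
    intro a b m n h v hv
    rw [coe_triStripFinset] at hv
    exact Finset.mem_coe.2 (h v hv)
  refine ((((determinedBy_triHCross _ _ _ _).mono (sub _ _ _ _ fun v hv => ?_)).inter
    ((determinedBy_triHCross _ _ _ _).mono (sub _ _ _ _ fun v hv => ?_))).inter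
    (((determinedBy_triVCross _ _ _ _).mono (sub _ _ _ _ fun v hv => ?_)).inter
    ((determinedBy_triVCross _ _ _ _).mono (sub _ _ _ _ fun v hv => ?_)))) <;>
  · rw [mem_triStrip] at hv
    rw [mem_triSqAnnulusFinset]
    push_cast at hv ⊢
    omega

/-- The closed-ring event is determined by the same annulus. [folklore] -/
theorem determinedBy_compl_preimage_triRingAt (z : Site 2) (k : ℕ) :
    DeterminedBy (compl ⁻¹' triRingAt z k) ↑(triSqAnnulusFinset z (17 * k) (31 * k)) := by
  have h := determinedBy_triRingAt z k
  rw [determinedBy_iff] at h ⊢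
  intro ω ω' hω
  rw [Set.mem_preimage, Set.mem_preimage]
  apply h
  ext v
  simp only [Set.mem_inter_iff, Set.mem_compl_iff]
  have key := Set.ext_iff.1 hω v
  simp only [Set.mem_inter_iff] at key
  constructor
  · rintro ⟨hv, hvS⟩
    exact ⟨fun hv' => hv (key.2 ⟨hv', hvS⟩).1, hvS⟩
  · rintro ⟨hv, hvS⟩
    exact ⟨fun hv' => hv (key.1 ⟨hv', hvS⟩).1, hvS⟩

/-- The ring event is increasing. [folklore] -/
theorem isUpperSet_triRingAt (z : Site 2) (k : ℕ) : IsUpperSet (triRingAt z k) :=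
  ((isUpperSet_triHCross _ _ _ _).inter (isUpperSet_triHCross _ _ _ _)).inter
    ((isUpperSet_triVCross _ _ _ _).inter (isUpperSet_triVCross _ _ _ _))

/-- The ring event is measurable. [folklore] -/
theorem measurableSet_triRingAt (z : Site 2) (k : ℕ) : MeasurableSet (triRingAt z k) :=
  (determinedBy_triRingAt z k).measurableSet_of_finset

/-- **RSW for rings, at density `q`**: `c ≤ P_q(LR(62k, 14k))` gives `c⁴ ≤ P_q(triRingAt z k)`
(Harris' inequality multiplies the four long-way crossing probabilities). [cite: Nolin2008, §4.4 Lemma 15 (proof) (arXiv 0711.4948: Lemma 14), with Thm. 11 "uniformly in p"] -/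
theorem le_real_triRingAt_of_rsw (q : unitInterval) {c : ℝ} (hc0 : 0 ≤ c) (z : Site 2) (k : ℕ)
    (hck : c ≤ triLRCrossingProb q (62 * k) (14 * k)) :
    c ^ 4 ≤ (triSitePercolation q).real (triRingAt z k) := by
  set F := triSqAnnulusFinset z (17 * k) (31 * k)
  have sub : ∀ (a b : ℤ) (m n : ℕ), (∀ v : Site 2, v ∈ triStrip a b m n → v ∈ F) →
      (↑(triStripFinset a b m n) : Set (Site 2)) ⊆ ↑F := by
    intro a b m n h v hv
    rw [coe_triStripFinset] at hv
    exact Finset.mem_coe.2 (h v hv)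
  have d1 : DeterminedBy (triHCross (z 0 - 31 * k) (z 1 + 17 * k) (62 * k) (14 * k)) ↑F :=
    (determinedBy_triHCross _ _ _ _).mono (sub _ _ _ _ fun v hv => by
      rw [mem_triStrip] at hv; rw [mem_triSqAnnulusFinset]; push_cast at hv ⊢; omega)
  have d2 : DeterminedBy (triHCross (z 0 - 31 * k) (z 1 - 31 * k) (62 * k) (14 * k)) ↑F :=
    (determinedBy_triHCross _ _ _ _).mono (sub _ _ _ _ fun v hv => by
      rw [mem_triStrip] at hv; rw [mem_triSqAnnulusFinset]; push_cast at hv ⊢; omega)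
  have d3 : DeterminedBy (triVCross (z 0 - 31 * k) (z 1 - 31 * k) (14 * k) (62 * k)) ↑F :=
    (determinedBy_triVCross _ _ _ _).mono (sub _ _ _ _ fun v hv => by
      rw [mem_triStrip] at hv; rw [mem_triSqAnnulusFinset]; push_cast at hv ⊢; omega)
  have d4 : DeterminedBy (triVCross (z 0 + 17 * k) (z 1 - 31 * k) (14 * k) (62 * k)) ↑F :=
    (determinedBy_triVCross _ _ _ _).mono (sub _ _ _ _ fun v hv => by
      rw [mem_triStrip] at hv; rw [mem_triSqAnnulusFinset]; push_cast at hv ⊢; omega)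
  have u1 := isUpperSet_triHCross (z 0 - 31 * k) (z 1 + 17 * k) (62 * k) (14 * k)
  have u2 := isUpperSet_triHCross (z 0 - 31 * k) (z 1 - 31 * k) (62 * k) (14 * k)
  have u3 := isUpperSet_triVCross (z 0 - 31 * k) (z 1 - 31 * k) (14 * k) (62 * k)
  have u4 := isUpperSet_triVCross (z 0 + 17 * k) (z 1 - 31 * k) (14 * k) (62 * k)
  have e1 := triSitePercolation_real_triHCross q (z 0 - 31 * k) (z 1 + 17 * k) (62 * k) (14 * k)
  have e2 := triSitePercolation_real_triHCross q (z 0 - 31 * k) (z 1 - 31 * k) (62 * k) (14 * k)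
  have e3 := triSitePercolation_real_triVCross q (z 0 - 31 * k) (z 1 - 31 * k) (14 * k) (62 * k)
  have e4 := triSitePercolation_real_triVCross q (z 0 + 17 * k) (z 1 - 31 * k) (14 * k) (62 * k)
  have hH := sitePercolation_harris q d1 d2 u1 u2
  have hV := sitePercolation_harris q d3 d4 u3 u4
  have hHV := sitePercolation_harris q (d1.inter d2) (d3.inter d4) (u1.inter u2) (u3.inter u4)
  unfold triSitePercolation at e1 e2 e3 e4 ⊢
  rw [e1, e2] at hH
  rw [e3, e4] at hV
  have h0 : 0 ≤ triLRCrossingProb q (62 * k) (14 * k) := measureReal_nonneg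
  calc c ^ 4 ≤ triLRCrossingProb q (62 * k) (14 * k) ^ 4 := by gcongr
    _ = (triLRCrossingProb q (62 * k) (14 * k) * triLRCrossingProb q (62 * k) (14 * k)) *
          (triLRCrossingProb q (62 * k) (14 * k) * triLRCrossingProb q (62 * k) (14 * k)) := by ring
    _ ≤ _ := (mul_le_mul hH hV (mul_nonneg h0 h0) measureReal_nonneg).trans hHV

/-- **Closed rings at `p` are open rings at `1 - p`**: `P_p(compl ⁻¹' triRingAt z k) = P_{1-p}(triRingAt z k)`. [folklore] -/
theorem real_compl_preimage_triRingAt (p : unitInterval) (z : Site 2) (k : ℕ) :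
    (triSitePercolation p).real (compl ⁻¹' triRingAt z k) = (triSitePercolation (unitInterval.symm p)).real (triRingAt z k) := by
  unfold triSitePercolation
  exact sitePercolation_real_preimage_compl p _

/-! ### Deterministic exclusion -/

/-- **A closed ring about `z`, present off a frozen set `L`, blocks every open path avoiding `L`
across its annulus.** If `ω'` agrees with `ω` off `L` and the ring at scale `k ≥ 1` about `z` is
closed in `ω'`, then no `ω`-open `𝕋`-path all of whose sites avoid `L` joins a site of the box
`{‖· - z‖_∞ ≤ 17k}` to a site outside `{‖· - z‖_∞ < 31k}`: such a path meets one of the four ring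
crossings (`PathIn.meets_annulus_crossings`) at a site closed in `ω'`, off `L` hence closed in `ω`,
but open in `ω`. (With `L = lower c_u z_u`: open paths of `above c_u` stay `17k` away from the tip
`z_u` — Nolin's circuits "preventing other disjoint black crossings to arrive near `z_u`".) [cite: Nolin2008, §4.4 Lemma 15 (proof) (arXiv 0711.4948: Lemma 14)] -/
theorem not_pathIn_of_closed_ring {z : Site 2} {k : ℕ} (hk : 1 ≤ k) {L A : Set (Site 2)}
    {ω ω' : SiteConfig (Site 2)} (hagree : ∀ v, v ∉ L → (v ∈ ω' ↔ v ∈ ω)) (hring : ω'ᶜ ∈ triRingAt z k)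
    (hA : A ⊆ Lᶜ ∩ ω) {s t : Site 2}
    (hs : z 0 - 17 * k ≤ s 0 ∧ s 0 ≤ z 0 + 17 * k ∧ z 1 - 17 * k ≤ s 1 ∧ s 1 ≤ z 1 + 17 * k)
    (ht : t 0 ≤ z 0 - 31 * k ∨ z 0 + 31 * k ≤ t 0 ∨ t 1 ≤ z 1 - 31 * k ∨ z 1 + 31 * k ≤ t 1) :
    ¬ PathIn triGraph A s t := by
  intro hP
  obtain ⟨⟨⟨xN, yN, hxN, hyN, hN⟩, ⟨xS, yS, hxS, hyS, hS⟩⟩, ⟨⟨xW, yW, hxW, hyW, hW⟩, ⟨xE, yE, hxE, hyE, hE⟩⟩⟩ := hring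
  have hk' : (1 : ℤ) ≤ k := by exact_mod_cast hk
  -- the ring crossings, inside the closed set `ω'ᶜ`
  set K : Set (Site 2) := triSqAnnulusFinset z (17 * k) (31 * k) ∩ ω'ᶜ with hK
  have strip_sub : ∀ {a b : ℤ} {m n : ℕ} {v : Site 2}, v ∈ triStrip a b m n ∩ ω'ᶜ →
      (z 0 - 31 * k ≤ a) → (a + m ≤ z 0 + 31 * k) → (z 1 - 31 * k ≤ b) → (b + n ≤ z 1 + 31 * k) →
      (a + m ≤ z 0 - 17 * k ∨ z 0 + 17 * k ≤ a ∨ b + n ≤ z 1 - 17 * k ∨ z 1 + 17 * k ≤ b) → v ∈ K := by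
    intro a b m n v hv h1 h2 h3 h4 h5
    rw [Set.mem_inter_iff, mem_triStrip] at hv
    refine ⟨Finset.mem_coe.2 (mem_triSqAnnulusFinset.2 ⟨⟨?_, ?_, ?_, ?_⟩, ?_⟩), hv.2⟩ <;> omega
  have hKb : ∀ v ∈ K, z 0 - 31 * k ≤ v 0 ∧ v 0 ≤ z 0 + 31 * k ∧ z 1 - 31 * k ≤ v 1 ∧ v 1 ≤ z 1 + 31 * k := by
    intro v hv
    have h := (mem_triSqAnnulusFinset.1 (Finset.mem_coe.1 hv.1)).1
    push_cast at h
    omega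
  have htop : ∃ u v, u 0 = z 0 - 31 * k ∧ v 0 = z 0 + 31 * k ∧ PathIn triGraph (K ∩ {w | z 1 + 17 * k ≤ w 1}) u v := by
    refine ⟨xN, yN, hxN, by rw [hyN]; push_cast; ring, hN.mono fun v hv => ⟨?_, ?_⟩⟩
    · exact strip_sub hv (by omega) (by push_cast; omega) (by omega) (by push_cast; omega) (by omega)
    · have := (mem_triStrip.1 hv.1).2.2.1; exact this
  have hbot : ∃ u v, u 0 = z 0 - 31 * k ∧ v 0 = z 0 + 31 * k ∧ PathIn triGraph (K ∩ {w | w 1 ≤ z 1 - 17 * k}) u v := by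
    refine ⟨xS, yS, hxS, by rw [hyS]; push_cast; ring, hS.mono fun v hv => ⟨?_, ?_⟩⟩
    · exact strip_sub hv (by omega) (by push_cast; omega) (by omega) (by push_cast; omega) (by push_cast; omega)
    · have := (mem_triStrip.1 hv.1).2.2.2; show v 1 ≤ z 1 - 17 * k; push_cast at this; omega
  have hleft : ∃ u v, u 1 = z 1 - 31 * k ∧ v 1 = z 1 + 31 * k ∧ PathIn triGraph (K ∩ {w | w 0 ≤ z 0 - 17 * k}) u v := by
    refine ⟨xW, yW, hxW, by rw [hyW]; push_cast; ring, hW.mono fun v hv => ⟨?_, ?_⟩⟩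
    · exact strip_sub hv (by omega) (by push_cast; omega) (by omega) (by push_cast; omega) (by push_cast; omega)
    · have := (mem_triStrip.1 hv.1).2.1; show v 0 ≤ z 0 - 17 * k; push_cast at this; omega
  have hright : ∃ u v, u 1 = z 1 - 31 * k ∧ v 1 = z 1 + 31 * k ∧ PathIn triGraph (K ∩ {w | z 0 + 17 * k ≤ w 0}) u v := by
    refine ⟨xE, yE, hxE, by rw [hyE]; push_cast; ring, hE.mono fun v hv => ⟨?_, ?_⟩⟩
    · exact strip_sub hv (by omega) (by push_cast; omega) (by omega) (by push_cast; omega) (by omega)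
    · have := (mem_triStrip.1 hv.1).1; exact this
  obtain ⟨x, hxA, hxK⟩ := PathIn.meets_annulus_crossings (A := A) (K := K)
    (L₂ := z 0 - 31 * k) (L₁ := z 0 - 17 * k) (R₁ := z 0 + 17 * k) (R₂ := z 0 + 31 * k)
    (B₂ := z 1 - 31 * k) (B₁ := z 1 - 17 * k) (T₁ := z 1 + 17 * k) (T₂ := z 1 + 31 * k)
    (by omega) (by omega) (by omega) (by omega) hKb htop hbot hleft hright hs ht hP
  -- `x` is open in `ω`, off `L`, hence open in `ω'`; but it is on the closed ring of `ω'`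
  have hx := hA hxA
  exact hxK.2 ((hagree x hx.1).2 hx.2)

/-! ### The per-scale RSW event with exclusion -/

/-- **The per-scale RSW event with exclusion**: open frames at the scales `k`, `8k` about `z`
(`trapRSW z k`: fence and protection) and a CLOSED ring in `{17k ≤ ‖·-z‖_∞ ≤ 31k}` (exclusion). [cite: Nolin2008, §4.4 Lemma 15 (proof) (arXiv 0711.4948: Lemma 14)] -/
def trapRSW₂ (z : Site 2) (k : ℕ) : Set (SiteConfig (Site 2)) := trapRSW z k ∩ compl ⁻¹' triRingAt z k

/-- `trapRSW₂ z k` is determined by the square annulus `{k ≤ ‖·-z‖_∞ ≤ 31k}`. [folklore] -/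
theorem determinedBy_trapRSW₂ (z : Site 2) (k : ℕ) : DeterminedBy (trapRSW₂ z k) ↑(triSqAnnulusFinset z k (31 * k)) := by
  refine ((determinedBy_trapRSW z k).mono ?_).inter ((determinedBy_compl_preimage_triRingAt z k).mono ?_)
  · intro v hv
    rw [Finset.mem_coe, mem_triSqAnnulusFinset] at hv ⊢; push_cast at hv ⊢; omega
  · intro v hv
    rw [Finset.mem_coe, mem_triSqAnnulusFinset] at hv ⊢; push_cast at hv ⊢; omega

/-- `trapRSW₂ z k` is measurable. [folklore] -/
theorem measurableSet_trapRSW₂ (z : Site 2) (k : ℕ) : MeasurableSet (trapRSW₂ z k) :=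
  (determinedBy_trapRSW₂ z k).measurableSet_of_finset

/-- **`P_p(trapRSW₂ z k) ≥ c_F² · c_E`** from open frames of probability `≥ c_F` at the scales `k`, `8k`
and a closed ring of probability `≥ c_E` (`0 ≤ c_E`): the two factors are determined by the disjoint
annuli `{k ≤ ‖·‖ ≤ 16k}` and `{17k ≤ ‖·‖ ≤ 31k}` (`k ≥ 1`). [cite: Nolin2008, §4.4 Lemma 15 (proof) (arXiv 0711.4948: Lemma 14), with Thm. 11 "uniformly in p"] -/
theorem real_trapRSW₂_ge_at (p : unitInterval) {cF cE : ℝ} (hcF : 0 < cF) (hcE : 0 ≤ cE) (z : Site 2) {k : ℕ}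
    (hk : 1 ≤ k) (h1 : cF ≤ (triSitePercolation p).real (triFrameAt z k))
    (h8 : cF ≤ (triSitePercolation p).real (triFrameAt z (8 * k)))
    (hE : cE ≤ (triSitePercolation p).real (compl ⁻¹' triRingAt z k)) :
    cF ^ 2 * cE ≤ (triSitePercolation p).real (trapRSW₂ z k) := by
  have hsq := sq_le_real_trapRSW_at p hcF z k h1 h8
  have hdisj : Disjoint (triSqAnnulusFinset z k (16 * k)) (triSqAnnulusFinset z (17 * k) (31 * k)) := by
    rw [Finset.disjoint_left]
    intro v hv hv'
    rw [mem_triSqAnnulusFinset] at hv hv'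
    push_cast at hv hv'
    omega
  unfold triSitePercolation at hsq hE ⊢
  rw [trapRSW₂, sitePercolation_real_inter_of_disjoint p (determinedBy_trapRSW z k)
    (determinedBy_compl_preimage_triRingAt z k) hdisj]
  exact mul_le_mul hsq hE hcE measureReal_nonneg

/-! ### Independent scales -/

/-- `31 k_i < k_j` for `i < j` (the scales grow by the factor `32`). [folklore] -/
theorem trapScale_lt₃₁ {k₀ : ℕ} (hk₀ : 1 ≤ k₀) {i j : ℕ} (hij : i < j) : 31 * trapScale k₀ i < trapScale k₀ j := by
  have h1 : trapScale k₀ (i + 1) ≤ trapScale k₀ j := Nat.mul_le_mul_left _ (Nat.pow_le_pow_right (by norm_num) hij)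
  have h2 := trapScale_succ k₀ i
  have h3 := one_le_trapScale hk₀ i
  omega

/-- The union of the wide annuli `{k_j ≤ ‖·-z‖_∞ ≤ 31 k_j}` of the scales below `K`. [folklore] -/
def trapScalesFinset₂ (z : Site 2) (k₀ K : ℕ) : Finset (Site 2) :=
  (Finset.range K).biUnion fun j => triSqAnnulusFinset z (trapScale k₀ j) (31 * trapScale k₀ j)

/-- The wide annulus of scale `K` is disjoint from those of the scales below `K`. [folklore] -/
theorem disjoint_trapScalesFinset₂ {k₀ : ℕ} (hk₀ : 1 ≤ k₀) (z : Site 2) (K : ℕ) :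
    Disjoint (trapScalesFinset₂ z k₀ K) (triSqAnnulusFinset z (trapScale k₀ K) (31 * trapScale k₀ K)) := by
  rw [trapScalesFinset₂, Finset.disjoint_biUnion_left]
  intro j hj
  rw [Finset.mem_range] at hj
  have hlt := trapScale_lt₃₁ hk₀ hj
  rw [Finset.disjoint_left]
  intro v hv hv'
  rw [mem_triSqAnnulusFinset] at hv hv'
  push_cast at hv hv'
  omega

/-- **Independent scales at density `p`, with exclusion**: if all open frames of scales `k < S`
about `z` have probability `≥ c_F` and all closed rings of scales `1 ≤ k < S'` have probability
`≥ c_E`, then along the scales `k_j = k₀ · 32^j`, `j < K`, with `8 k_j < S`, `k_j < S'`,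
`P_p(⋂_{j<K} (trapRSW₂ z k_j)ᶜ) ≤ (1 - c_F² c_E)^K`, and this event is determined by the union of
the wide annuli of the scales. [cite: Nolin2008, §4.4 Lemma 15 (proof) (arXiv 0711.4948: Lemma 14, (4.18)), with Thm. 11 "uniformly in p"] -/
theorem real_iInter_compl_trapRSW₂_le_at (p : unitInterval) {cF cE : ℝ} (hcF : 0 < cF) (hcE : 0 ≤ cE) {S S' : ℕ}
    (hF : ∀ (z : Site 2) (k : ℕ), 1 ≤ k → k < S → cF ≤ (triSitePercolation p).real (triFrameAt z k))
    (hEr : ∀ (z : Site 2) (k : ℕ), 1 ≤ k → k < S' → cE ≤ (triSitePercolation p).real (compl ⁻¹' triRingAt z k))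
    (z : Site 2) {k₀ : ℕ} (hk₀ : 1 ≤ k₀) :
    ∀ K : ℕ, (∀ j < K, 8 * trapScale k₀ j < S) → (∀ j < K, trapScale k₀ j < S') →
      (triSitePercolation p).real (⋂ j ∈ Finset.range K, (trapRSW₂ z (trapScale k₀ j))ᶜ) ≤ (1 - cF ^ 2 * cE) ^ K ∧
        DeterminedBy (⋂ j ∈ Finset.range K, (trapRSW₂ z (trapScale k₀ j))ᶜ) ↑(trapScalesFinset₂ z k₀ K)
  | 0 => fun _ _ => by
    constructor
    · simp
    · simp only [Finset.range_zero, Finset.notMem_empty, Set.iInter_of_empty, Set.iInter_univ]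
      exact determinedBy_univ _
  | K + 1 => fun hKS hKS' => by
    obtain ⟨ihle, ihdet⟩ := real_iInter_compl_trapRSW₂_le_at p hcF hcE hF hEr z hk₀ K
      (fun j hj => hKS j (Nat.lt_succ_of_lt hj)) (fun j hj => hKS' j (Nat.lt_succ_of_lt hj))
    have hsplit : (⋂ j ∈ Finset.range (K + 1), (trapRSW₂ z (trapScale k₀ j))ᶜ) =
        (⋂ j ∈ Finset.range K, (trapRSW₂ z (trapScale k₀ j))ᶜ) ∩ (trapRSW₂ z (trapScale k₀ K))ᶜ := by
      rw [Finset.range_add_one, Finset.set_biInter_insert, Set.inter_comm]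
    have hdetK : DeterminedBy (trapRSW₂ z (trapScale k₀ K))ᶜ ↑(triSqAnnulusFinset z (trapScale k₀ K) (31 * trapScale k₀ K)) :=
      (determinedBy_trapRSW₂ z (trapScale k₀ K)).compl
    have hK8 : 8 * trapScale k₀ K < S := hKS K (Nat.lt_succ_self K)
    have hKS1 : trapScale k₀ K < S' := hKS' K (Nat.lt_succ_self K)
    have hK1 : 1 ≤ trapScale k₀ K := one_le_trapScale hk₀ K
    constructor
    · rw [hsplit]
      unfold triSitePercolation at ihle hF hEr ⊢
      rw [sitePercolation_real_inter_of_disjoint p ihdet hdetK (disjoint_trapScalesFinset₂ hk₀ z K)]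
      have hc : (sitePercolation (Site 2) p).real (trapRSW₂ z (trapScale k₀ K))ᶜ ≤ 1 - cF ^ 2 * cE := by
        rw [measureReal_compl (measurableSet_trapRSW₂ _ _), probReal_univ]
        have := real_trapRSW₂_ge_at p hcF hcE z hK1 (hF z _ hK1 (by omega)) (hF z _ (by omega) (by omega))
          (hEr z _ hK1 hKS1)
        unfold triSitePercolation at this
        linarith
      have h1 : 0 ≤ 1 - cF ^ 2 * cE := le_trans measureReal_nonneg hc
      rw [pow_succ]
      exact mul_le_mul ihle hc measureReal_nonneg (pow_nonneg h1 K)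
    · rw [hsplit]
      refine (ihdet.mono ?_).inter (hdetK.mono ?_)
      · intro v hv
        rw [Finset.mem_coe, trapScalesFinset₂, Finset.mem_biUnion] at hv ⊢
        obtain ⟨j, hj, hv⟩ := hv
        exact ⟨j, Finset.mem_range.2 (Nat.lt_succ_of_lt (Finset.mem_range.1 hj)), hv⟩
      · intro v hv
        rw [Finset.mem_coe, trapScalesFinset₂, Finset.mem_biUnion]
        exact ⟨K, Finset.self_mem_range_succ K, hv⟩

/-! ### The per-scale success event with exclusion and the union bound -/

/-- **The fence of `c` at scale `k` succeeds in `ω`, with exclusion**: `TrapFenceOK M c z k ω` (fence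
in the corner box and protection from above) AND no `ω`-open `𝕋`-path off `lower c z` joins the box
`{‖· - z‖_∞ ≤ 17k}` to the outside of `{‖· - z‖_∞ < 31k}`. [cite: Nolin2008, §4.4 Lemma 15 (proof) (arXiv 0711.4948: Lemma 14)] -/
def TrapFenceOK₂ (M : ℕ) (c : Finset (Site 2)) (z : Site 2) (k : ℕ) (ω : SiteConfig (Site 2)) : Prop :=
  TrapFenceOK M c z k ω ∧
    ∀ s t : Site 2, (z 0 - 17 * k ≤ s 0 ∧ s 0 ≤ z 0 + 17 * k ∧ z 1 - 17 * k ≤ s 1 ∧ s 1 ≤ z 1 + 17 * k) →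
      (t 0 ≤ z 0 - 31 * k ∨ z 0 + 31 * k ≤ t 0 ∨ t 1 ≤ z 1 - 31 * k ∨ z 1 + 31 * k ≤ t 1) →
      ¬ PathIn triGraph ((↑((trapDomain M).lower c z) : Set (Site 2))ᶜ ∩ ω) s t

/-- **One good configuration off `lower c z` suffices**, with exclusion (`1 ≤ k`, `16k + 1 ≤ M`). [cite: Nolin2008, §4.4 Lemma 15 (proof) (arXiv 0711.4948: Lemma 14)] -/
theorem trapFenceOK₂_of_mem_trapRSW₂ {M k : ℕ} {c : Finset (Site 2)} {z : Site 2} (hk : 1 ≤ k)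
    (hkM : 16 * (k : ℤ) + 1 ≤ M) (hc : (trapDomain M).IsCrossing c z) {ω ω' : SiteConfig (Site 2)}
    (hcω : (↑c : Set (Site 2)) ⊆ ω) (hagree : ∀ v, v ∉ (trapDomain M).lower c z → (v ∈ ω' ↔ v ∈ ω))
    (hω' : ω' ∈ trapRSW₂ z k) : TrapFenceOK₂ M c z k ω := by
  refine ⟨trapFenceOK_of_mem_trapRSW hk hkM hc hcω hagree hω'.1, fun s t hs ht => ?_⟩
  refine not_pathIn_of_closed_ring hk (L := ↑((trapDomain M).lower c z)) (fun v hv => hagree v ?_) ?_ subset_rfl hs ht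
  · exact fun h => hv (Finset.mem_coe.2 h)
  · have : ω'ᶜ ∈ triRingAt z k := hω'.2
    exact this

/-- **Failure of the `u`-th lowest crossing, with exclusion**: the `u`-th term exists and its
fence-with-exclusion fails on all the scales `k_j`, `j < K`. [cite: Nolin2008, §4.4 Lemma 15 (proof) (arXiv 0711.4948: Lemma 14)] -/
def TrapSeqFail₂ (M u k₀ K : ℕ) (ω : SiteConfig (Site 2)) : Prop :=
  ∃ c z, (trapDomain M).lowestSeq ω u = some (c, z) ∧ ∀ j < K, ¬ TrapFenceOK₂ M c z (trapScale k₀ j) ω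

/-- Every failure with exclusion that is not a plain failure still comes from the absence of a
good configuration off `lower c z`: `TrapNoRSW₂` — no configuration agreeing with `ω` off
`lower c z` lies in any `trapRSW₂ z k_j`. [cite: Nolin2008, §4.4 Lemma 15 (proof) (arXiv 0711.4948: Lemma 14)] -/
def TrapNoRSW₂ (M : ℕ) (c : Finset (Site 2)) (z : Site 2) (k₀ K : ℕ) (ω : SiteConfig (Site 2)) : Prop :=
  ∀ j < K, ∀ ω' : SiteConfig (Site 2), (∀ v, v ∉ (trapDomain M).lower c z → (v ∈ ω' ↔ v ∈ ω)) →
    ω' ∉ trapRSW₂ z (trapScale k₀ j)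

/-- `TrapNoRSW₂` is determined by the sites of the wide annuli that are off `lower c z`. [folklore] -/
theorem determinedBy_trapNoRSW₂ (M : ℕ) (c : Finset (Site 2)) (z : Site 2) (k₀ K : ℕ) :
    DeterminedBy {ω | TrapNoRSW₂ M c z k₀ K ω} ↑(trapScalesFinset₂ z k₀ K \ (trapDomain M).lower c z) := by
  classical
  rw [determinedBy_iff]
  suffices h : ∀ ω₁ ω₂ : Set (Site 2),
      ω₁ ∩ ↑(trapScalesFinset₂ z k₀ K \ (trapDomain M).lower c z) = ω₂ ∩ ↑(trapScalesFinset₂ z k₀ K \ (trapDomain M).lower c z) →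
      TrapNoRSW₂ M c z k₀ K ω₁ → TrapNoRSW₂ M c z k₀ K ω₂ from
    fun ω₁ ω₂ hω => ⟨h ω₁ ω₂ hω, h ω₂ ω₁ hω.symm⟩
  intro ω₁ ω₂ hω h j hj ω' hagree hω'
  set A := triSqAnnulusFinset z (trapScale k₀ j) (31 * trapScale k₀ j) with hA
  set ω'' : Set (Site 2) := {v | if v ∈ A then v ∈ ω' else v ∈ ω₁} with hω''
  have hA' : ω'' ∩ ↑A = ω' ∩ ↑A := by
    ext v
    simp only [hω'', Set.mem_inter_iff, Set.mem_setOf_eq, Finset.mem_coe]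
    constructor
    · rintro ⟨h1, h2⟩; rw [if_pos h2] at h1; exact ⟨h1, h2⟩
    · rintro ⟨h1, h2⟩; rw [if_pos h2]; exact ⟨h1, h2⟩
  have hmem : ω'' ∈ trapRSW₂ z (trapScale k₀ j) :=
    ((determinedBy_iff _ _).1 (determinedBy_trapRSW₂ z (trapScale k₀ j)) ω'' ω' hA').2 hω'
  refine h j hj ω'' (fun v hv => ?_) hmem
  simp only [hω'', Set.mem_setOf_eq]
  split_ifs with hvA
  · rw [hagree v hv]
    have : v ∈ (↑(trapScalesFinset₂ z k₀ K \ (trapDomain M).lower c z) : Set (Site 2)) := by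
      rw [Finset.coe_sdiff]
      refine ⟨Finset.mem_coe.2 ?_, hv⟩
      rw [trapScalesFinset₂, Finset.mem_biUnion]
      exact ⟨j, Finset.mem_range.2 hj, hvA⟩
    have key := Set.ext_iff.1 hω v
    simp only [Set.mem_inter_iff] at key
    constructor
    · intro h2; exact (key.2 ⟨h2, this⟩).1
    · intro h1; exact (key.1 ⟨h1, this⟩).1
  · exact Iff.rfl

/-- On `{lowestSeq u = (c, z)}`, failure with exclusion on all scales forces `TrapNoRSW₂`
(`16 k_{j} + 1 ≤ M`). [cite: Nolin2008, §4.4 Lemma 15 (proof) (arXiv 0711.4948: Lemma 14)] -/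
theorem trapNoRSW₂_of_fail {M u k₀ K : ℕ} (hk₀ : 1 ≤ k₀) (hKM : ∀ j < K, 16 * (trapScale k₀ j : ℤ) + 1 ≤ M)
    {ω : SiteConfig (Site 2)} {c : Finset (Site 2)} {z : Site 2} (h : (trapDomain M).lowestSeq ω u = some (c, z))
    (hfail : ∀ j < K, ¬ TrapFenceOK₂ M c z (trapScale k₀ j) ω) : TrapNoRSW₂ M c z k₀ K ω := by
  intro j hj ω' hagree hω'
  obtain ⟨hc, hcω⟩ := JDomain.isCrossing_of_lowestSeq h
  exact hfail j hj (trapFenceOK₂_of_mem_trapRSW₂ (one_le_trapScale hk₀ j) (hKM j hj) hc hcω hagree hω')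

/-- `TrapNoRSW₂ ⊆ ⋂_j (trapRSW₂ z k_j)ᶜ` (take `ω' = ω`). [folklore] -/
theorem trapNoRSW₂_subset (M : ℕ) (c : Finset (Site 2)) (z : Site 2) (k₀ K : ℕ) :
    {ω | TrapNoRSW₂ M c z k₀ K ω} ⊆ ⋂ j ∈ Finset.range K, (trapRSW₂ z (trapScale k₀ j))ᶜ := by
  intro ω hω
  simp only [Set.mem_iInter, Set.mem_compl_iff]
  intro j hj
  exact hω j (Finset.mem_range.1 hj) ω (fun v _ => Iff.rfl)

/-- **The union bound over the values of the `u`-th lowest crossing, with exclusion, at density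
`p`** (Nolin 2008, (4.18)–(4.19)): if all open frames of scales `k < M` have `P_p ≥ c_F` and all
closed rings of scales `1 ≤ k`, `32 k < M` have `P_p ≥ c_E`, then
`P_p(TrapSeqFail₂ M u k₀ K) ≤ P_p(lowestSeq u ≠ none) · (1 - c_F² c_E)^K` (`32 k_j + 1 ≤ M` for
`j < K`). Proof verbatim that of `real_trapSeqFail_le_at`. [cite: Nolin2008, §4.4 Lemma 15 (proof) (arXiv 0711.4948: Lemma 14, (4.19)), with Thm. 11 "uniformly in p"] -/
theorem real_trapSeqFail₂_le_at (p : unitInterval) {cF cE : ℝ} (hcF : 0 < cF) (hcF1 : cF ≤ 1) (hcE : 0 ≤ cE)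
    (hcE1 : cE ≤ 1) {M : ℕ}
    (hF : ∀ (z : Site 2) (k : ℕ), 1 ≤ k → k < M → cF ≤ (triSitePercolation p).real (triFrameAt z k))
    (hEr : ∀ (z : Site 2) (k : ℕ), 1 ≤ k → 32 * k < M → cE ≤ (triSitePercolation p).real (compl ⁻¹' triRingAt z k))
    {u k₀ K : ℕ} (hM : 1 ≤ M) (hk₀ : 1 ≤ k₀) (hKM : ∀ j < K, 32 * (trapScale k₀ j : ℤ) + 1 ≤ M) :
    (triSitePercolation p).real {ω | TrapSeqFail₂ M u k₀ K ω} ≤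
      (triSitePercolation p).real {ω | (trapDomain M).lowestSeq ω u ≠ none} * (1 - cF ^ 2 * cE) ^ K := by
  classical
  have hcut := trapDomain_cutProp M
  have hdual := trapDomain_dualProp hM
  have hKS : ∀ j < K, 8 * trapScale k₀ j < M := fun j hj => by have := hKM j hj; omega
  have hKS' : ∀ j < K, trapScale k₀ j < (M - 1) / 32 + 1 := fun j hj => by have := hKM j hj; omega
  have hKM' : ∀ j < K, 16 * (trapScale k₀ j : ℤ) + 1 ≤ M := fun j hj => by have := hKM j hj; omega
  have hEr' : ∀ (z : Site 2) (k : ℕ), 1 ≤ k → k < (M - 1) / 32 + 1 → cE ≤ (triSitePercolation p).real (compl ⁻¹' triRingAt z k) :=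
    fun z k hk hkS => hEr z k hk (by omega)
  set μ := triSitePercolation p with hμ
  set E : Finset (Site 2) × Site 2 → Set (SiteConfig (Site 2)) :=
    fun q => {ω | (trapDomain M).lowestSeq ω u = some q} with hE
  have hsub : {ω | TrapSeqFail₂ M u k₀ K ω} ⊆ ⋃ q ∈ trapPairs M, (E q ∩ {ω | TrapNoRSW₂ M q.1 q.2 k₀ K ω}) := by
    rintro ω ⟨c, z, h, hfail⟩
    simp only [Set.mem_iUnion, Set.mem_inter_iff, Set.mem_setOf_eq]
    exact ⟨(c, z), mem_trapPairs_of_lowestSeq h, h, trapNoRSW₂_of_fail hk₀ hKM' h hfail⟩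
  have hterm : ∀ q ∈ trapPairs M, μ.real (E q ∩ {ω | TrapNoRSW₂ M q.1 q.2 k₀ K ω}) ≤ μ.real (E q) * (1 - cF ^ 2 * cE) ^ K := by
    rintro ⟨c, z⟩ -
    have hEdet : DeterminedBy (E (c, z)) ↑((trapDomain M).lower c z) :=
      JDomain.determinedBy_lowestSeq_eq hcut hdual u c z
    have hNdet := determinedBy_trapNoRSW₂ M c z k₀ K
    have hdisj : Disjoint ((trapDomain M).lower c z) (trapScalesFinset₂ z k₀ K \ (trapDomain M).lower c z) :=
      Finset.disjoint_sdiff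
    rw [hμ]
    unfold triSitePercolation
    rw [sitePercolation_real_inter_of_disjoint p hEdet hNdet hdisj]
    refine mul_le_mul_of_nonneg_left ?_ measureReal_nonneg
    have h1 := (real_iInter_compl_trapRSW₂_le_at p hcF hcE hF hEr' z hk₀ K hKS hKS').1
    unfold triSitePercolation at h1
    exact (measureReal_mono (trapNoRSW₂_subset M c z k₀ K)).trans h1
  have hmeas : ∀ q ∈ trapPairs M, MeasurableSet (E q) := fun q _ =>
    (JDomain.determinedBy_lowestSeq_eq hcut hdual u q.1 q.2).measurableSet_of_finset
  have hdisjE : (↑(trapPairs M) : Set (Finset (Site 2) × Site 2)).PairwiseDisjoint E := fun q _ q' _ hqq' =>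
    JDomain.disjoint_setOf_lowestSeq_eq hqq'
  have hunion : μ.real (⋃ q ∈ trapPairs M, E q) ≤ μ.real {ω | (trapDomain M).lowestSeq ω u ≠ none} := by
    refine measureReal_mono ?_
    intro ω hω
    simp only [Set.mem_iUnion, Set.mem_setOf_eq] at hω ⊢
    obtain ⟨q, -, hq⟩ := hω
    rw [hq]; exact Option.some_ne_none q
  have h0 : 0 ≤ 1 - cF ^ 2 * cE := by nlinarith
  calc μ.real {ω | TrapSeqFail₂ M u k₀ K ω}
      ≤ μ.real (⋃ q ∈ trapPairs M, (E q ∩ {ω | TrapNoRSW₂ M q.1 q.2 k₀ K ω})) :=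
        measureReal_mono hsub (measure_ne_top _ _)
    _ ≤ ∑ q ∈ trapPairs M, μ.real (E q ∩ {ω | TrapNoRSW₂ M q.1 q.2 k₀ K ω}) := measureReal_biUnion_finset_le _ _
    _ ≤ ∑ q ∈ trapPairs M, μ.real (E q) * (1 - cF ^ 2 * cE) ^ K := Finset.sum_le_sum hterm
    _ = (∑ q ∈ trapPairs M, μ.real (E q)) * (1 - cF ^ 2 * cE) ^ K := (Finset.sum_mul _ _ _).symm
    _ = μ.real (⋃ q ∈ trapPairs M, E q) * (1 - cF ^ 2 * cE) ^ K := by rw [measureReal_biUnion_finset hdisjE hmeas]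
    _ ≤ μ.real {ω | (trapDomain M).lowestSeq ω u ≠ none} * (1 - cF ^ 2 * cE) ^ K :=
        mul_le_mul_of_nonneg_right hunion (pow_nonneg h0 K)

/-! ### Consequence: spacing of same-colour tips -/

/-- **Later terms stay away from a protected tip.** On `TrapFenceOK₂ M c z k ω` for the `u`-th
term `(c, z)`, every `v`-th term `(c', z')` with `u < v` has its tip outside the box
`{‖· - z‖_∞ ≤ 17k}`: `c'` is an `ω`-open connected set lying above `c` (off `lower c z`), containing
a site of the inner side `trapI` (at horizontal distance `≥ M - 1 ≥ 31k` from the tip column) and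
its tip `z'`. (`1 ≤ k`, `32 k ≤ M`.) [cite: Nolin2008, §4.4 Lemma 15 (proof) (arXiv 0711.4948: Lemma 14, "preventing other disjoint black crossings to arrive near z_u")] -/
theorem lowestSeq_tip_far_of_trapFenceOK₂ {M u v k : ℕ} (hk : 1 ≤ k) (hkM : 32 * (k : ℤ) ≤ M) {ω : SiteConfig (Site 2)}
    {c c' : Finset (Site 2)} {z z' : Site 2}
    (hu : (trapDomain M).lowestSeq ω u = some (c, z)) (hv : (trapDomain M).lowestSeq ω v = some (c', z'))
    (huv : u < v) (hok : TrapFenceOK₂ M c z k ω) :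
    ¬ (z 0 - 17 * k ≤ z' 0 ∧ z' 0 ≤ z 0 + 17 * k ∧ z 1 - 17 * k ≤ z' 1 ∧ z' 1 ≤ z 1 + 17 * k) := by
  intro hbox
  have hcut := trapDomain_cutProp M
  obtain ⟨hc', hc'ω⟩ := JDomain.isCrossing_of_lowestSeq hv
  have habove : c' ⊆ (trapDomain M).above c z := JDomain.lowestSeq_subset_above_of_lt hcut huv hu hv
  obtain ⟨f, hf, hfF⟩ := hc'.exists_start
  -- the path inside `c'` from the tip to a start site, off `lower c z`, open
  have hpath : PathIn triGraph ((↑((trapDomain M).lower c z) : Set (Site 2))ᶜ ∩ ω) z' f := by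
    refine (hc'.conn z' hc'.tip_mem f hf).mono fun x hx => ⟨?_, hc'ω hx⟩
    intro hxl
    have hxD : x ∈ (trapDomain M).D := hc'.subset (Finset.mem_coe.1 hx)
    exact (JDomain.mem_lower_iff_not_mem_above hxD).1 (Finset.mem_coe.1 hxl) (habove (Finset.mem_coe.1 hx))
  have hzO := trapO_coord (JDomain.isCrossing_of_lowestSeq hu).1.tip_mem_J
  have hfI : f 0 = (M : ℤ) + 1 := (mem_trapI.1 (show f ∈ trapI M from hfF)).2
  exact hok.2 z' f hbox (Or.inl (by rw [hfI]; omega)) hpath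

end Literature.Probability.Percolation
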